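import Mathlib

/-!
# Polymath 8a, Lemma 3.1: the combinatorial lemma behind the Heath-Brown identity reduction

Support file for the named fact `Literature.NumberTheory.Sieve.mpz_of_lt` (**parity.S29**,
`ParityWave0.lean`): D. H. J. Polymath, *New equidistribution estimates of Zhang type*, Algebra &
Number Theory 8:9 (2014) 2067–2199 = arXiv:1402.0811.  The printed proof of Theorem 2.4 begins with
Lemma 2.7 ("combinatorial lemma": the Type I/II/III estimates imply `MPZ^{(i)}[ϖ, δ]`), proved in §3
from the Heath-Brown identity (Lemma 3.3; in the tree as `heathBrown_identity`,
`HeathBrownIdentity.lean`) and "a purely combinatorial result about finite sets of non-negative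
numbers", Lemma 3.1, which sorts the scales `N_k ∼ x^{t_k}`, `t_1 + ⋯ + t_n = 1`, of a Dirichlet
convolution into the Type 0 / Type I–II / Type III alternatives.  This file PROVES Lemma 3.1 as
printed (`Polymath8a.combinatorialLemma`), including its last clause (no Type III alternative when
`σ > 1/6`, `Polymath8a.combinatorialLemma_of_one_sixth_lt`), following the printed proof
(large/small sets, powerful/powerless elements).

## References

* D. H. J. Polymath, *New equidistribution estimates of Zhang type*, Algebra & Number Theory 8:9
  (2014), 2067–2199, arXiv:1402.0811: Lemma 3.1 and its proof. [cite: Polymath8a2014]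
-/

open Finset

namespace Literature.NumberTheory.Sieve

namespace Polymath8a

section CombinatorialLemma

variable {ι : Type*} {σ : ℝ} {t : ι → ℝ}

/-- Proof of Lemma 3.1, first step: if the Type I/II alternative fails, every sum `∑_{i ∈ S} t_i`
avoids the interval `(1/2 − σ, 1/2 + σ)` ("every set is either large or small"; take `T = Sᶜ`,
possibly after swapping `S` and `T`). [cite: Polymath8a2014, proof of Lemma 3.1] -/
theorem combinatorialLemma_dichotomy [Fintype ι] [DecidableEq ι] (hsum : ∑ i, t i = 1)
    (hI : ∀ S : Finset ι, ¬(1 / 2 - σ < ∑ i ∈ S, t i ∧ ∑ i ∈ S, t i ≤ ∑ i ∈ Sᶜ, t i ∧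
      ∑ i ∈ Sᶜ, t i < 1 / 2 + σ))
    (S : Finset ι) : ∑ i ∈ S, t i ≤ 1 / 2 - σ ∨ 1 / 2 + σ ≤ ∑ i ∈ S, t i := by
  by_contra h
  push Not at h
  have hc : ∀ T : Finset ι, ∑ i ∈ Tᶜ, t i = 1 - ∑ i ∈ T, t i := fun T => by
    rw [← hsum, ← Finset.sum_compl_add_sum T]; ring
  rcases le_or_gt (∑ i ∈ S, t i) (1 / 2) with h2 | h2
  · exact hI S ⟨h.1, by rw [hc]; linarith, by rw [hc]; linarith⟩
  · refine hI Sᶜ ⟨by rw [hc]; linarith, ?_, ?_⟩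
    · rw [compl_compl, hc]; linarith
    · rw [compl_compl]; exact h.2

/-- Proof of Lemma 3.1: adding a *powerless* element (one that never turns a small set into a large
one) to a small set keeps it small. [cite: Polymath8a2014, proof of Lemma 3.1] -/
theorem combinatorialLemma_small_insert [DecidableEq ι]
    (hdich : ∀ S : Finset ι, ∑ i ∈ S, t i ≤ 1 / 2 - σ ∨ 1 / 2 + σ ≤ ∑ i ∈ S, t i)
    {i : ι} (hi : ¬∃ S : Finset ι, i ∉ S ∧ ∑ l ∈ S, t l ≤ 1 / 2 - σ ∧
      1 / 2 + σ ≤ ∑ l ∈ insert i S, t l)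
    {S : Finset ι} (hS : ∑ l ∈ S, t l ≤ 1 / 2 - σ) : ∑ l ∈ insert i S, t l ≤ 1 / 2 - σ := by
  by_cases hiS : i ∈ S
  · rwa [Finset.insert_eq_of_mem hiS]
  · rcases hdich (insert i S) with h | h
    · exact h
    · exact absurd ⟨S, hiS, hS, h⟩ hi

/-- Proof of Lemma 3.1: "the union of a small set and a set of powerless elements is small".
[cite: Polymath8a2014, proof of Lemma 3.1] -/
theorem combinatorialLemma_small_union [DecidableEq ι]
    (hdich : ∀ S : Finset ι, ∑ i ∈ S, t i ≤ 1 / 2 - σ ∨ 1 / 2 + σ ≤ ∑ i ∈ S, t i)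
    (P : Finset ι) (hP : ∀ i ∈ P, ¬∃ S : Finset ι, i ∉ S ∧ ∑ l ∈ S, t l ≤ 1 / 2 - σ ∧
      1 / 2 + σ ≤ ∑ l ∈ insert i S, t l)
    {S : Finset ι} (hS : ∑ l ∈ S, t l ≤ 1 / 2 - σ) : ∑ l ∈ S ∪ P, t l ≤ 1 / 2 - σ := by
  induction P using Finset.induction_on with
  | empty => simpa using hS
  | insert j P hjP ih =>
    rw [Finset.union_insert]
    exact combinatorialLemma_small_insert hdich (hP j (Finset.mem_insert_self j P))
      (ih fun i hi => hP i (Finset.mem_insert_of_mem hi))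

/-- Proof of Lemma 3.1: if the Type 0 alternative fails (singletons are small), a large set has at
least two elements. [cite: Polymath8a2014, proof of Lemma 3.1] -/
theorem combinatorialLemma_two_le_of_large (hσ : 0 < σ) (h0 : ∀ i, t i < 1 / 2 + σ)
    {S : Finset ι} (hS : 1 / 2 + σ ≤ ∑ i ∈ S, t i) : ∃ i ∈ S, ∃ j ∈ S, i ≠ j := by
  rw [← Finset.one_lt_card]
  by_contra hc
  push Not at hc
  rcases S.eq_empty_or_nonempty with rfl | ⟨x, hx⟩
  · rw [Finset.sum_empty] at hS; linarith
  · have hSx : S = {x} :=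
      Finset.eq_singleton_iff_unique_mem.mpr ⟨hx, fun y hy => Finset.card_le_one.mp hc y hy x hx⟩
    rw [hSx, Finset.sum_singleton] at hS
    linarith [h0 x]

/-- **Lemma 3.1** (Polymath 8a, the combinatorial lemma of §3). Let `1/10 < σ < 1/2` and let
`t_1, …, t_n` be non-negative reals with `t_1 + ⋯ + t_n = 1`.  Then at least one of the following
holds: **(Type 0)** some `t_i ≥ 1/2 + σ`; **(Type I/II)** there is a partition `{1,…,n} = S ∪ T`
with `1/2 − σ < ∑_{i ∈ S} t_i ≤ ∑_{i ∈ T} t_i < 1/2 + σ`; **(Type III)** there are distinct `i, j, k`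
with `2σ ≤ t_i ≤ t_j ≤ t_k ≤ 1/2 − σ` and `t_i + t_j, t_i + t_k, t_j + t_k ≥ 1/2 + σ`.  (Indexed
here by an arbitrary finite type; `T = Sᶜ`.  The hypotheses `σ < 1/2` and `t_i ≥ 0` printed in the
lemma are used nowhere in the printed proof and are omitted.)  Printed proof: if Type 0 and Type I/II fail, every set is small (`∑ ≤ 1/2 − σ`) or
large (`∑ ≥ 1/2 + σ`); call `i` powerful if it turns some small set not containing it into a large
one; the powerless elements form a small set, whence at least three powerful elements exist, each
has `t_i ≥ 2σ`, any two form a large pair since `4σ > 1/2 − σ`, and singletons are small.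
[cite: Polymath8a2014, Lemma 3.1] -/
theorem combinatorialLemma [Fintype ι] [DecidableEq ι] (hσ : 1 / 10 < σ) (hsum : ∑ i, t i = 1) :
    (∃ i, 1 / 2 + σ ≤ t i) ∨
    (∃ S : Finset ι, 1 / 2 - σ < ∑ i ∈ S, t i ∧ ∑ i ∈ S, t i ≤ ∑ i ∈ Sᶜ, t i ∧
      ∑ i ∈ Sᶜ, t i < 1 / 2 + σ) ∨
    (∃ i j k : ι, i ≠ j ∧ i ≠ k ∧ j ≠ k ∧ 2 * σ ≤ t i ∧ t i ≤ t j ∧ t j ≤ t k ∧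
      t k ≤ 1 / 2 - σ ∧ 1 / 2 + σ ≤ t i + t j ∧ 1 / 2 + σ ≤ t i + t k ∧ 1 / 2 + σ ≤ t j + t k) := by
  refine or_iff_not_imp_left.mpr fun h0 => or_iff_not_imp_left.mpr fun hI => ?_
  push Not at h0
  have hI' : ∀ S : Finset ι, ¬(1 / 2 - σ < ∑ i ∈ S, t i ∧ ∑ i ∈ S, t i ≤ ∑ i ∈ Sᶜ, t i ∧
      ∑ i ∈ Sᶜ, t i < 1 / 2 + σ) := fun S hS => hI ⟨S, hS⟩
  have hσ0 : 0 < σ := by linarith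
  -- every set is small or large
  have hdich := combinatorialLemma_dichotomy hsum hI'
  have hc : ∀ T : Finset ι, ∑ i ∈ Tᶜ, t i = 1 - ∑ i ∈ T, t i := fun T => by
    rw [← hsum, ← Finset.sum_compl_add_sum T]; ring
  -- singletons are small
  have h1 : ∀ i, t i ≤ 1 / 2 - σ := fun i => by
    rcases hdich {i} with h | h
    · simpa using h
    · rw [Finset.sum_singleton] at h; linarith [h0 i]
  -- powerful elements: `pw i`
  set pw : ι → Prop := fun i => ∃ S : Finset ι, i ∉ S ∧ ∑ l ∈ S, t l ≤ 1 / 2 - σ ∧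
    1 / 2 + σ ≤ ∑ l ∈ insert i S, t l with hpw
  -- a powerful element has `t i ≥ 2σ`
  have h2 : ∀ i, pw i → 2 * σ ≤ t i := fun i ⟨S, hiS, hS, hL⟩ => by
    rw [Finset.sum_insert hiS] at hL; linarith
  -- two distinct powerful elements form a large pair
  have h3 : ∀ i j, i ≠ j → pw i → pw j → 1 / 2 + σ ≤ t i + t j := fun i j hij hi hj => by
    rcases hdich {i, j} with h | h
    · rw [Finset.sum_pair hij] at h; linarith [h2 i hi, h2 j hj]
    · rwa [Finset.sum_pair hij] at h
  -- the set `P` of powerless elements is small, and so is `{i} ∪ P` for any `i`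
  classical
  set P : Finset ι := Finset.univ.filter fun i => ¬pw i with hP
  have hPmem : ∀ i, i ∈ P ↔ ¬pw i := fun i => by simp [hP]
  have hP' : ∀ i ∈ P, ¬pw i := fun i hi => (hPmem i).mp hi
  have h0small : ∑ l ∈ (∅ : Finset ι), t l ≤ 1 / 2 - σ := by
    rcases hdich ∅ with h | h
    · exact h
    · rw [Finset.sum_empty] at h; linarith
  have hPsmall : ∑ l ∈ P, t l ≤ 1 / 2 - σ := by
    simpa using combinatorialLemma_small_union hdich P hP' h0small
  -- hence at least one powerful element `i` …
  have hPc : 1 / 2 + σ ≤ ∑ l ∈ Pᶜ, t l := by rw [hc]; linarith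
  obtain ⟨i, hi, -, -, -⟩ := combinatorialLemma_two_le_of_large hσ0 h0 hPc
  have hipw : pw i := by
    by_contra hn; exact (Finset.mem_compl.mp hi) ((hPmem i).mpr hn)
  -- … and two further powerful elements `j, k` in the complement of the small set `{i} ∪ P`
  have hiP : ∑ l ∈ {i} ∪ P, t l ≤ 1 / 2 - σ :=
    combinatorialLemma_small_union hdich P hP' (by simpa using h1 i)
  have hiPc : 1 / 2 + σ ≤ ∑ l ∈ ({i} ∪ P)ᶜ, t l := by rw [hc]; linarith
  obtain ⟨j, hj, k, hk, hjk⟩ := combinatorialLemma_two_le_of_large hσ0 h0 hiPc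
  rw [Finset.mem_compl, Finset.mem_union, Finset.mem_singleton, not_or] at hj hk
  have hjpw : pw j := by by_contra hn; exact hj.2 ((hPmem j).mpr hn)
  have hkpw : pw k := by by_contra hn; exact hk.2 ((hPmem k).mpr hn)
  have hij : i ≠ j := fun h => hj.1 h.symm
  have hik : i ≠ k := fun h => hk.1 h.symm
  -- assemble, sorting the three powerful elements
  have key : ∀ a b c : ι, a ≠ b → a ≠ c → b ≠ c → pw a → pw b → pw c → t a ≤ t b → t b ≤ t c →
      ∃ i j k : ι, i ≠ j ∧ i ≠ k ∧ j ≠ k ∧ 2 * σ ≤ t i ∧ t i ≤ t j ∧ t j ≤ t k ∧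
        t k ≤ 1 / 2 - σ ∧ 1 / 2 + σ ≤ t i + t j ∧ 1 / 2 + σ ≤ t i + t k ∧
        1 / 2 + σ ≤ t j + t k :=
    fun a b c hab hac hbc ha hb hc' hab' hbc' =>
      ⟨a, b, c, hab, hac, hbc, h2 a ha, hab', hbc', h1 c, h3 a b hab ha hb, h3 a c hac ha hc',
        h3 b c hbc hb hc'⟩
  rcases le_total (t i) (t j) with hij' | hij'
  · rcases le_total (t j) (t k) with hjk' | hjk'
    · exact key i j k hij hik hjk hipw hjpw hkpw hij' hjk'
    · rcases le_total (t i) (t k) with hik' | hik'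
      · exact key i k j hik hij hjk.symm hipw hkpw hjpw hik' hjk'
      · exact key k i j hik.symm hjk.symm hij hkpw hipw hjpw hik' hij'
  · rcases le_total (t i) (t k) with hik' | hik'
    · exact key j i k hij.symm hjk hik hjpw hipw hkpw hij' hik'
    · rcases le_total (t j) (t k) with hjk' | hjk'
      · exact key j k i hjk hij.symm hik.symm hjpw hkpw hipw hjk' hik'
      · exact key k j i hjk.symm hik.symm hij.symm hkpw hjpw hipw hjk' hij'

/-- **Lemma 3.1, last clause**: "if `σ > 1/6`, then the Type III alternative cannot occur" (the
inequalities `2σ ≤ t_i ≤ ⋯ ≤ 1/2 − σ` are inconsistent), so for `1/6 < σ` one of Type 0 or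
Type I/II holds. [cite: Polymath8a2014, Lemma 3.1] -/
theorem combinatorialLemma_of_one_sixth_lt [Fintype ι] [DecidableEq ι] (hσ : 1 / 6 < σ)
    (hsum : ∑ i, t i = 1) :
    (∃ i, 1 / 2 + σ ≤ t i) ∨
    (∃ S : Finset ι, 1 / 2 - σ < ∑ i ∈ S, t i ∧ ∑ i ∈ S, t i ≤ ∑ i ∈ Sᶜ, t i ∧
      ∑ i ∈ Sᶜ, t i < 1 / 2 + σ) := by
  rcases combinatorialLemma (σ := σ) (by linarith) hsum with h | h | ⟨i, j, k, -, -, -, h1, h2, h3, h4, -⟩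
  · exact Or.inl h
  · exact Or.inr h
  · exfalso; linarith

end CombinatorialLemma

end Polymath8a

end Literature.NumberTheory.Sieve
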